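import Summits.ValiantsHypothesis.ValiantsHypothesis.Theorems.PolyaContinuedMonotoneCoverHardIdleSplitCard

/-!
# Crux `MonotoneCoverHard` (stmt-ValiantsHypothesis-7421), width line — **mixing must be massive**:
a fiber of width `c` has at least `c²/2 − c` LATE READERS

(val-width-7421-p4 g0, 2026-08-28; lane «width ≥ 3 at one level ⇒ non-Pfaffian».)

Quantitative form of `false_of_pure_fiber` (`…PureFiber.lean`).  Setting as there: a levelled
label-bijective Pfaffian cover of `per_n`, a weight-nonzero perfect matching `τ₀` with label permutation
`σ₀`, a level `ℓ₀`, `K` = the label-rows read by `τ₀` at row level `ℓ₀` (`#K = c_{ℓ₀}` = the width),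
and the FIBER of `τ₀` over `K` (weight-nonzero perfect matchings carrying `x_{k σ₀ k}`, `k ∉ K`).
A LATE READER is a row of level `> ℓ₀` that carries a label with label-row in `K` in some fiber
matching; an early reader one of level `< ℓ₀`.

* `sq_le_two_mul_card_lateReaders` — if the fiber has no early readers (automatic when `ℓ₀` is the
  lowest variable level, e.g. the lower level of a two-level cover), then
  `#K² ≤ 2 · (#K + #{late readers})`.  So a pure fiber (`0` late readers) has `#K ≤ 2`
  (`false_of_pure_fiber`), and a level of width `c` forces `≥ c²/2 − c` rows ABOVE it to read its
  label-rows inside every single fiber: level-mixing, when it happens, is massive.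

Proof: fiber substitution + the quantitative idle-split engine `sq_le_two_mul_card_of_idleSplit` with
`U` = rows above `ℓ₀` that are not late readers, `P` = rows below `ℓ₀` ∪ idle rows at `ℓ₀`; the rows
outside `U ∪ P` are the `#K` variable `τ₀`-rows plus the late readers.  VP ≠ VNP is not moved;
`MonotoneCoverHard` stays open.  No definitions.
-/

namespace Summit.ValiantsHypothesis.ValiantsHypothesis.Theorems.PolyaContinuedMonotoneCoverHard

-- summit = sub-problem name (single-conjunct summit, D-0017 layout), so the namespace repeats it
set_option linter.dupNamespace false

open scoped Classical
open Finset
open Literature.Computability.AlgebraicComplexity (perPoly)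

/-- **Late readers.**  `τ₀` a weight-nonzero perfect matching with label permutation `σ₀`, `ℓ₀` a
level, `K` the label-rows read by `τ₀` at row level `ℓ₀` (`hK`), `3 ≤ #K`; if no fiber matching reads a
label with label-row in `K` below level `ℓ₀` (`hearly`), then
`#K² ≤ 2 · (#K + #{rows above ℓ₀ reading a K-label in some fiber matching})`. -/
theorem sq_le_two_mul_card_lateReaders (n m : ℕ) (E : Finset (Fin m × Fin m))
    (a : Fin m × Fin m → MvPolynomial (Fin n × Fin n) ℂ)
    (hsig : ∃ s : Fin m × Fin m → ℂ, (∀ e, s e = 1 ∨ s e = -1) ∧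
      (Matrix.of fun i j => if (i, j) ∈ E then MvPolynomial.C (s (i, j)) * MvPolynomial.X (i, j)
          else 0 : Matrix (Fin m) (Fin m) (MvPolynomial (Fin m × Fin m) ℂ)).det =
        (Matrix.of fun i j => if (i, j) ∈ E then MvPolynomial.X (i, j) else 0 :
          Matrix (Fin m) (Fin m) (MvPolynomial (Fin m × Fin m) ℂ)).permanent)
    (ha : ∀ e, (∃ j, a e = MvPolynomial.X j) ∨ a e = 0 ∨ a e = 1)
    (hper : perPoly (Fin n) ℂ =
      MvPolynomial.aeval a (Matrix.of fun i j => if (i, j) ∈ E then MvPolynomial.X (i, j) else 0 :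
          Matrix (Fin m) (Fin m) (MvPolynomial (Fin m × Fin m) ℂ)).permanent)
    (g : Fin m ⊕ Fin m → ℕ)
    (hg : ∀ τ : Equiv.Perm (Fin m), (∀ i, (i, τ i) ∈ E ∧ a (i, τ i) ≠ 0) → ∀ i,
      ((∃ k, a (i, τ i) = MvPolynomial.X k) → g (Sum.inr (τ i)) = g (Sum.inl i) + 1) ∧
      ((¬ ∃ k, a (i, τ i) = MvPolynomial.X k) → g (Sum.inr (τ i)) = g (Sum.inl i)))
    (τ₀ : Equiv.Perm (Fin m)) (hτ₀ : ∀ i, (i, τ₀ i) ∈ E ∧ a (i, τ₀ i) ≠ 0)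
    (σ₀ : Equiv.Perm (Fin n)) (hσ₀ : ∀ i j, a (i, τ₀ i) = MvPolynomial.X j → σ₀ j.1 = j.2)
    (ℓ₀ : ℕ) (K : Finset (Fin n)) (hK3 : 3 ≤ K.card)
    (hK : ∀ i (k : Fin n), a (i, τ₀ i) = MvPolynomial.X (k, σ₀ k) → (k ∈ K ↔ g (Sum.inl i) = ℓ₀))
    (hearly : ∀ τ : Equiv.Perm (Fin m), (∀ i, (i, τ i) ∈ E ∧ a (i, τ i) ≠ 0) →
      (∀ k, k ∉ K → ∃ i, a (i, τ i) = MvPolynomial.X (k, σ₀ k)) →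
      ∀ i (j : Fin n × Fin n), a (i, τ i) = MvPolynomial.X j → j.1 ∈ K → ℓ₀ ≤ g (Sum.inl i)) :
    K.card ^ 2 ≤ 2 * (K.card + (univ.filter fun i : Fin m => ℓ₀ < g (Sum.inl i) ∧
      ∃ τ : Equiv.Perm (Fin m), (∀ i, (i, τ i) ∈ E ∧ a (i, τ i) ≠ 0) ∧
        (∀ k, k ∉ K → ∃ i, a (i, τ i) = MvPolynomial.X (k, σ₀ k)) ∧
        ∃ v : Fin n × Fin n, a (i, τ i) = MvPolynomial.X v ∧ v.1 ∈ K).card) := by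
  set f : Fin n × Fin n → MvPolynomial (Fin K.card × Fin K.card) ℂ := fun v =>
    if hk : v.1 ∈ K then
      (if hl : σ₀.symm v.2 ∈ K then
        (MvPolynomial.X (K.equivFin ⟨v.1, hk⟩, K.equivFin ⟨σ₀.symm v.2, hl⟩) :
          MvPolynomial (Fin K.card × Fin K.card) ℂ)
      else 0)
    else if v.2 = σ₀ v.1 then 1 else 0 with hf
  set a' : Fin m × Fin m → MvPolynomial (Fin K.card × Fin K.card) ℂ :=
    fun e => MvPolynomial.aeval f (a e) with ha'def
  have ha'ap : ∀ e, a' e = MvPolynomial.aeval f (a e) := fun e => rfl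
  have hX0 : ∀ j, (MvPolynomial.X j : MvPolynomial (Fin K.card × Fin K.card) ℂ) ≠ 0 :=
    fun j => MvPolynomial.X_ne_zero j
  have hX1 : ∀ j, (MvPolynomial.X j : MvPolynomial (Fin K.card × Fin K.card) ℂ) ≠ 1 := by
    intro j h
    have h1 := congrArg MvPolynomial.totalDegree h
    rw [MvPolynomial.totalDegree_X, MvPolynomial.totalDegree_one] at h1
    exact one_ne_zero h1
  -- the four values of `f`
  have hfX : ∀ v : Fin n × Fin n, ∀ (hk : v.1 ∈ K) (hl : σ₀.symm v.2 ∈ K),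
      f v = MvPolynomial.X (K.equivFin ⟨v.1, hk⟩, K.equivFin ⟨σ₀.symm v.2, hl⟩) := by
    intro v hk hl
    rw [hf]
    simp only
    rw [dif_pos hk, dif_pos hl]
  have hf0 : ∀ v : Fin n × Fin n, v.1 ∈ K → σ₀.symm v.2 ∉ K → f v = 0 := by
    intro v hk hl
    rw [hf]
    simp only
    rw [dif_pos hk, dif_neg hl]
  have hf1 : ∀ v : Fin n × Fin n, v.1 ∉ K → v.2 = σ₀ v.1 → f v = 1 := by
    intro v hk hl
    rw [hf]
    simp only
    rw [dif_neg hk, if_pos hl]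
  have hf0' : ∀ v : Fin n × Fin n, v.1 ∉ K → v.2 ≠ σ₀ v.1 → f v = 0 := by
    intro v hk hl
    rw [hf]
    simp only
    rw [dif_neg hk, if_neg hl]
  have ha'X : ∀ e v, a e = MvPolynomial.X v → a' e = f v := by
    intro e v hv
    rw [ha'ap, hv, MvPolynomial.aeval_X]
  -- label shape of the substituted cover
  have ha' : ∀ e, (∃ j, a' e = MvPolynomial.X j) ∨ a' e = 0 ∨ a' e = 1 := by
    intro e
    rcases ha e with ⟨v, hv⟩ | h | h
    · rw [ha'X e v hv]
      by_cases hk : v.1 ∈ K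
      · by_cases hl : σ₀.symm v.2 ∈ K
        · exact Or.inl ⟨_, hfX v hk hl⟩
        · exact Or.inr (Or.inl (hf0 v hk hl))
      · by_cases hl : v.2 = σ₀ v.1
        · exact Or.inr (Or.inr (hf1 v hk hl))
        · exact Or.inr (Or.inl (hf0' v hk hl))
    · right; left
      rw [ha'ap, h, map_zero]
    · right; right
      rw [ha'ap, h, map_one]
  -- F1: a new variable label comes from an old variable label with label-row in `K`
  have hF1 : ∀ e j', a' e = MvPolynomial.X j' → ∃ v, a e = MvPolynomial.X v ∧ v.1 ∈ K := by
    intro e j' h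
    rcases ha e with ⟨v, hv⟩ | h0 | h1
    · refine ⟨v, hv, ?_⟩
      by_contra hk
      rw [ha'X e v hv] at h
      by_cases hl : v.2 = σ₀ v.1
      · rw [hf1 v hk hl] at h
        exact hX1 j' h.symm
      · rw [hf0' v hk hl] at h
        exact hX0 j' h.symm
    · exfalso
      rw [ha'ap, h0, map_zero] at h
      exact hX0 j' h.symm
    · exfalso
      rw [ha'ap, h1, map_one] at h
      exact hX1 j' h.symm
  -- F2: new-nonzero labels are old-nonzero
  have hF2 : ∀ e, a' e ≠ 0 → a e ≠ 0 := by
    intro e h h0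
    apply h
    rw [ha'ap, h0, map_zero]
  -- F3: a new-good matching is old-good and carries the labels `x_{k σ₀ k}`, `k ∉ K`
  have hF3 : ∀ τ : Equiv.Perm (Fin m), (∀ i, (i, τ i) ∈ E ∧ a' (i, τ i) ≠ 0) →
      (∀ i, (i, τ i) ∈ E ∧ a (i, τ i) ≠ 0) ∧
      (∀ k, k ∉ K → ∃ i, a (i, τ i) = MvPolynomial.X (k, σ₀ k)) := by
    intro τ hτ
    have hτold : ∀ i, (i, τ i) ∈ E ∧ a (i, τ i) ≠ 0 := fun i => ⟨(hτ i).1, hF2 _ (hτ i).2⟩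
    refine ⟨hτold, fun k hk => ?_⟩
    obtain ⟨σ, -, hσ2⟩ := exists_perm_labels E a ha hper τ hτold
    obtain ⟨i, hi, -⟩ := hσ2 k
    have hne := (hτ i).2
    rw [ha'X _ _ hi] at hne
    by_cases hl : σ k = σ₀ k
    · exact ⟨i, by rw [hi, hl]⟩
    · exact absurd (hf0' (k, σ k) hk hl) hne
  -- F4: a used variable edge of the substituted cover leaves a row of level `≥ ℓ₀`; if the row is
  -- above `ℓ₀` it is a LATE READER
  have hF4 : ∀ i j, (∃ τ : Equiv.Perm (Fin m), (∀ k, (k, τ k) ∈ E ∧ a' (k, τ k) ≠ 0) ∧ τ i = j) →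
      (∃ k, a' (i, j) = MvPolynomial.X k) → ℓ₀ ≤ g (Sum.inl i) ∧
        (ℓ₀ < g (Sum.inl i) → ∃ τ : Equiv.Perm (Fin m), (∀ i, (i, τ i) ∈ E ∧ a (i, τ i) ≠ 0) ∧
          (∀ k, k ∉ K → ∃ i, a (i, τ i) = MvPolynomial.X (k, σ₀ k)) ∧
          ∃ v : Fin n × Fin n, a (i, τ i) = MvPolynomial.X v ∧ v.1 ∈ K) := by
    rintro i j ⟨τ, hτ, rfl⟩ ⟨k', hk'⟩
    obtain ⟨hτold, hagree⟩ := hF3 τ hτ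
    obtain ⟨v, hv, hvK⟩ := hF1 _ _ hk'
    exact ⟨hearly τ hτold hagree i v hv hvK, fun _ => ⟨τ, hτold, hagree, v, hv, hvK⟩⟩
  -- … and enters a column of level `≥ ℓ₀ + 1`
  have hF4' : ∀ i j, (∃ τ : Equiv.Perm (Fin m), (∀ k, (k, τ k) ∈ E ∧ a' (k, τ k) ≠ 0) ∧ τ i = j) →
      (∃ k, a' (i, j) = MvPolynomial.X k) → ℓ₀ + 1 ≤ g (Sum.inr j) := by
    rintro i j ⟨τ, hτ, rfl⟩ ⟨k', hk'⟩
    obtain ⟨hτold, hagree⟩ := hF3 τ hτ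
    obtain ⟨v, hv, hvK⟩ := hF1 _ _ hk'
    rw [(hg τ hτold i).1 ⟨v, hv⟩]
    have := hearly τ hτold hagree i v hv hvK
    omega
  -- F5: `τ₀` is a weight-nonzero perfect matching of the substituted cover
  have hτ₀' : ∀ i, (i, τ₀ i) ∈ E ∧ a' (i, τ₀ i) ≠ 0 := by
    intro i
    refine ⟨(hτ₀ i).1, ?_⟩
    rcases ha (i, τ₀ i) with ⟨v, hv⟩ | h0 | h1
    · have hv2 : v.2 = σ₀ v.1 := (hσ₀ i v hv).symm
      rw [ha'X _ _ hv]
      by_cases hk : v.1 ∈ K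
      · have hl : σ₀.symm v.2 ∈ K := by rw [hv2, Equiv.symm_apply_apply]; exact hk
        rw [hfX v hk hl]
        exact hX0 _
      · rw [hf1 v hk hv2]
        exact one_ne_zero
    · exact absurd h0 (hτ₀ i).2
    · rw [ha'ap, h1, map_one]
      exact one_ne_zero
  -- F6: a level-`ℓ₀` row whose `τ₀`-edge is not variable in the substituted cover is an idle row
  have hF6 : ∀ i, g (Sum.inl i) = ℓ₀ → (¬ ∃ k, a' (i, τ₀ i) = MvPolynomial.X k) →
      g (Sum.inr (τ₀ i)) = ℓ₀ := by
    intro i hi hnv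
    have hflat : ¬ ∃ k, a (i, τ₀ i) = MvPolynomial.X k := by
      rintro ⟨v, hv⟩
      have hv2 : v.2 = σ₀ v.1 := (hσ₀ i v hv).symm
      by_cases hk : v.1 ∈ K
      · apply hnv
        have hl : σ₀.symm v.2 ∈ K := by rw [hv2, Equiv.symm_apply_apply]; exact hk
        exact ⟨_, by rw [ha'X _ _ hv, hfX v hk hl]⟩
      · have hv' : a (i, τ₀ i) = MvPolynomial.X (v.1, σ₀ v.1) := by
          rw [hv, ← hv2]
        exact hk ((hK i v.1 hv').2 hi)
    rw [(hg τ₀ hτ₀ i).2 hflat, hi]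
  -- the substituted cover computes `per_{#K}`
  have hper' : perPoly (Fin K.card) ℂ =
      MvPolynomial.aeval a' (Matrix.of fun i j => if (i, j) ∈ E then MvPolynomial.X (i, j) else 0 :
          Matrix (Fin m) (Fin m) (MvPolynomial (Fin m × Fin m) ℂ)).permanent := by
    rw [← aeval_fiberSubst_perPoly K σ₀, hper, MvPolynomial.comp_aeval_apply]
  -- the variable rows of `τ₀` in the substituted cover number `#K`
  have hvarK := card_var_eq E a' ha' hper' τ₀ hτ₀'
  -- quantitative engine: `U` = rows above `ℓ₀` that are not late readers,
  -- `P` = rows below `ℓ₀` ∪ idle rows at `ℓ₀`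
  have h := sq_le_two_mul_card_of_idleSplit K.card m hK3 E a' hsig ha' hper' τ₀ hτ₀'
    (fun i => ℓ₀ < g (Sum.inl i) ∧ ¬ ∃ τ : Equiv.Perm (Fin m), (∀ i, (i, τ i) ∈ E ∧ a (i, τ i) ≠ 0) ∧
      (∀ k, k ∉ K → ∃ i, a (i, τ i) = MvPolynomial.X (k, σ₀ k)) ∧
      ∃ v : Fin n × Fin n, a (i, τ i) = MvPolynomial.X v ∧ v.1 ∈ K)
    (fun i => g (Sum.inl i) < ℓ₀ ∨ (g (Sum.inl i) = ℓ₀ ∧ ¬ ∃ k, a' (i, τ₀ i) = MvPolynomial.X k))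
    ?_ ?_ ?_ ?_ ?_
  · refine h.trans (Nat.mul_le_mul_left 2 ?_)
    rw [Fintype.card_subtype]
    refine le_trans (Finset.card_le_card (t :=
      (univ.filter fun i : Fin m => ∃ j, a' (i, τ₀ i) = MvPolynomial.X j) ∪
      (univ.filter fun i : Fin m => ℓ₀ < g (Sum.inl i) ∧
        ∃ τ : Equiv.Perm (Fin m), (∀ i, (i, τ i) ∈ E ∧ a (i, τ i) ≠ 0) ∧
          (∀ k, k ∉ K → ∃ i, a (i, τ i) = MvPolynomial.X (k, σ₀ k)) ∧
          ∃ v : Fin n × Fin n, a (i, τ i) = MvPolynomial.X v ∧ v.1 ∈ K)) ?_)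
      (le_trans (Finset.card_union_le _ _) (by rw [hvarK]))
    intro i hi
    obtain ⟨hU, hP⟩ := (Finset.mem_filter.1 hi).2
    rw [Finset.mem_union, Finset.mem_filter, Finset.mem_filter]
    rcases Nat.lt_trichotomy (g (Sum.inl i)) ℓ₀ with hlt | heq | hgt
    · exact absurd (Or.inl hlt) hP
    · left
      refine ⟨Finset.mem_univ _, ?_⟩
      by_contra hnv
      exact hP (Or.inr ⟨heq, hnv⟩)
    · right
      refine ⟨Finset.mem_univ _, hgt, ?_⟩
      by_contra hlate
      exact hU ⟨hgt, hlate⟩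
  · -- `U`-rows have non-variable `τ₀`-edges
    rintro i ⟨hU, hlate⟩ hv
    exact hlate ((hF4 i (τ₀ i) ⟨τ₀, hτ₀', rfl⟩ hv).2 hU)
  · -- `P`-rows have non-variable `τ₀`-edges
    intro i hP hv
    rcases hP with h | ⟨-, h⟩
    · have := (hF4 i (τ₀ i) ⟨τ₀, hτ₀', rfl⟩ hv).1
      omega
    · exact h hv
  · -- `U`-rows emit no used variable edge
    rintro i j ⟨hU, hlate⟩ hu hv
    exact hlate ((hF4 i j hu hv).2 hU)
  · -- no used variable edge from outside `U` into the `τ₀`-columns of `P`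
    intro i i' _ hP hu hv
    have h1 := hF4' i (τ₀ i') hu hv
    rcases hP with h | ⟨h, hnv⟩
    · have h2 := hg τ₀ hτ₀ i'
      by_cases hvi : ∃ k, a (i', τ₀ i') = MvPolynomial.X k
      · have := h2.1 hvi
        omega
      · have := h2.2 hvi
        omega
    · have := hF6 i' h hnv
      omega
  · -- no used edge from `U` into the `τ₀`-columns of `P`
    rintro i i' ⟨hU, -⟩ hP _ hu
    obtain ⟨τ, hτ, hτi⟩ := hu
    obtain ⟨hτold, -⟩ := hF3 τ hτ
    have h2 := hg τ hτold i
    rw [hτi] at h2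
    have hge : ℓ₀ + 1 ≤ g (Sum.inr (τ₀ i')) := by
      by_cases hvi : ∃ k, a (i, τ₀ i') = MvPolynomial.X k
      · have := h2.1 hvi
        omega
      · have := h2.2 hvi
        omega
    rcases hP with h | ⟨h, hnv⟩
    · have h3 := hg τ₀ hτ₀ i'
      by_cases hvi : ∃ k, a (i', τ₀ i') = MvPolynomial.X k
      · have := h3.1 hvi
        omega
      · have := h3.2 hvi
        omega
    · have := hF6 i' h hnv
      omega

end Summit.ValiantsHypothesis.ValiantsHypothesis.Theorems.PolyaContinuedMonotoneCoverHard
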